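import Literature.Barriers.CriticalPhenomena.PlaquetteWalkHoleRootThinBoxCells
import Literature.Barriers.CriticalPhenomena.PlaquetteWalkHoleRootRingThreeDoor
import HarnessLib

/-!
# Barrier catalogue (SAWScalingLimit): THE DEAD DOOR BELOW — two rows under a domino hole the under route is EMPTY

Leaf of `PlaquetteWalkHoleRootHoleColumn` (the even–odd rule for the lower east: a winding excursion crosses the west
sides of the root column below the root row an odd number of times) and `PlaquetteWalkHoleRootPrefixLoop` (the prefix
loop `C` of an under-walk, its one winding number along the excursion polygon `J`, and its jump across the root edge).
Setting: root plaquette `w` rooted at `W`, hole `holeFaceW w = (w.1 − 1, w.2) ∉ D`, far cell `farW w = (w.1 − 2, w.2)`;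
`holeS = (w.1 − 1, w.2 − 1)`, `rootS w = (w.1, w.2 − 1)`, `rootSS w = (w.1, w.2 − 2)`.

§1 ★★★★ `ΩG.false_of_under_excursion_rootSS_W` — THE SECOND PREFIX-LOOP SEPARATION: if the door between `holeS` and
`rootS` is DEAD (one of the two cells absent) no class-`B2a` UNDER-walk's excursion polygon crosses the west side of
`rootSS w`. For `J` passes through the midpoint of the far cell's top side, joined to the UPPER corner of the root edge
along the top sides of the far cell and of the hole (off `C`, `PlaquetteWalkHoleRootPrefixLoop` §4 verbatim), and through
the midpoint of that west side, joined to the LOWER corner of the root edge along the west side of `rootS w` — a dead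
door is never a prefix mid-edge — and the upper half of the west side of `rootSS w` — the excursion's own mid-edge, so not
the prefix's; one winding number of `C` along `J`, two different ones at the corners (`ΩG.windC_jump`).
§2 ★★★ `ΩG.exists_nth_eq_rootSS_W_of_AJ_ne_zero_deadDoor` — dead door + FLOOR (`(w.1 − 1, y) ∉ D` for `y ≤ w.2 − 3`):
the odd west-edge crossings of the lower east (`ΩG.odd_card_westEdgeLE_of_AJ_ne_zero`) are all crossings of the west side
of `rootSS w`; wound form for either orientation of the winding witness.
§3 ★★★★★ `ΩG.WE_eq_excursionWinding_of_under_deadDoor_floor` — **DEAD DOOR + FLOOR ⇒ NO WOUND UNDER-WALK** (every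
domain); the lane's tight-room datum «hole two rows above the bottom wall, `holeS` or `rootS` removed ⇒ no wound
under-walk ≤ 40 arcs in the 5 × 5 frame» (kit j295595) as a theorem with no size bound and no frame; row-mirror twin
`ΩG.WE_eq_excursionWinding_of_over_deadDoor_ceiling` (`holeN`/`rootN`, ceiling two rows above ⇒ no wound OVER-walk) by
`ΩG.mirrorFar`; vacuous kills and vanishing route masses.
§3′ the vertex functional with one route empty and abstract witnesses for the other (`Im VF > 0` / `< 0` on the whole
range `[π/3, 2π/3]`), and `VF ≡ 0` when both doors are dead with floor and ceiling. The box catalogue (tight bottom / tight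
top at distance one, the height-four thin box) is the companion leaf `PlaquetteWalkHoleRootTightNearCells`.

Not in print; venture lane «pcv-sawmu», seat b-step0 gen 28 (FINDING-YB-KILL-FORCED-ZEROS §24; kit j295594/j295595:
`NONE ≤ 40` in the 5 × 5 frame for all four cells, `TIMEOUT` in the one-row-wider frames — decided here: none).

References: A. Glazman, I. Manolescu, arXiv:1708.00395v3, §1 (Fig. 1, Fig. 2, remark after eq. (1)), §2.1, §4.2, Lemma 2.1
[GlazmanManolescu2019]; A. Glazman, Electron. Commun. Probab. 20 (2015) no. 86, Lemma 3.1, proof pp. 6–7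
[Glazman2015WeightedSAW]; R. Courant, H. Robbins, *What is Mathematics?* (1941/1958), Ch. V Appendix §2 (the even–odd
rule) [CourantRobbins1958]; L. V. Ahlfors, *Complex Analysis*, 3rd ed. (1979), Ch. 4 §2.1 (the index of a point with
respect to a closed curve) [AhlforsCA1979].
-/

noncomputable section

open Set Function Complex
open Literature.Topology.PlaneTopology

namespace Literature.Probability.RandomPlanarGeometry.SAW.YangBaxter

open Real
open Literature.Barriers.CriticalPhenomena.PlaquetteWalk (mirrorRowFace)

open private rev_snd_nth rev_snd_length rev_firstHit from Literature.Probability.RandomPlanarGeometry.YangBaxterSAWGeneralDomain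

open private mem_segment_toC sideSeg_coords_W eq_side_of_mem_crossSeg_sideSeg not_mem_sideSeg_of_mem_arcSeg
  from Literature.Probability.RandomPlanarGeometry.YangBaxterSAWExcursionJordan

open private len_eq side_jOut segment_pJ_even toC_midPt_side_mem_sideSeg
  from Literature.Probability.RandomPlanarGeometry.YangBaxterSAWExcursionJordan

open private fSeg_coords hSeg_coords toC_midPt_mem_crossSeg not_mem_sideSeg_N_of_mem_fSeg_hSeg
  from Literature.Barriers.CriticalPhenomena.PlaquetteWalkHoleRootPrefixLoop

/-! ## §0 Coordinates -/

section Coords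

variable (w : Face)

/-- The `W` side of `rootSS w = (w.1, w.2 − 2)`, in coordinates. [cite: GlazmanManolescu2019, §1 (mid-edges)] -/
theorem rootSS_side_W_eq : (rootSS w).side .W = MidEdge.vert w.1 (w.2 - 2) := by
  obtain ⟨a, b⟩ := w; rfl

/-- The two segments through the hole miss every closed west side on the root column's line below the root row.
[folklore] -/
private theorem not_mem_sideSeg_W_of_mem_fSeg_hSeg {c : Face} (hc1 : c.1 = w.1) (hc2 : c.2 ≤ w.2 - 1) {q : ℂ}
    (hq : q ∈ fSeg w ∨ q ∈ hSeg w) : q ∉ sideSeg c .W := by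
  intro hq'
  obtain ⟨hx, -, hy⟩ := sideSeg_coords_W hq'
  rw [hc1] at hx
  have hc2' : (c.2 : ℝ) ≤ w.2 - 1 := by exact_mod_cast hc2
  rcases hq with hq | hq
  · obtain ⟨t, -, ht1, hx', -⟩ := fSeg_coords w hq
    rw [hx'] at hx; linarith
  · obtain ⟨hy', -, -⟩ := hSeg_coords w hq
    rw [hy'] at hy; linarith

end Coords

namespace ΩG

variable {D : Set Face} {w : Face} {ω : ΩG D (w.side .W) (farW w)}

/-! ## §1 The second prefix-loop separation: a dead door `holeS | rootS` keeps every under-excursion off the west side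
of `rootSS` -/

/-- ★★★★ **THE SECOND PREFIX-LOOP SEPARATION LEMMA.** Hole absent, the door between `holeS = (w.1 − 1, w.2 − 1)` and
`rootS w` DEAD (one of its two cells absent), `ω` a class-`B2a` UNDER-walk at the far cell (first side `S`). Then no
slot of the excursion polygon exits through the west side of `rootSS w = (w.1, w.2 − 2)`. Proof: the prefix loop `C`
(`PlaquetteWalkHoleRootPrefixLoop`) has one winding number along `J`; `J` passes through the midpoint of the far cell's
top side, joined to the upper corner of the root edge along the top sides of the far cell and of the hole (never prefix
mid-edges), and — if some slot exits through that west side — through its midpoint, joined to the lower corner of the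
root edge along the west side of `rootS w` (a dead door is no mid-edge of the walk) and the upper half of the west side
of `rootSS w` (the excursion's mid-edge, hence not the prefix's: a mid-edge is crossed once); all four pieces miss `C`, but
the winding numbers of `C` about the two corners differ by one.
[cite: CourantRobbins1958, Ch. V Appendix §2 (The Jordan Curve Theorem for Polygons: the even–odd rule)]
[cite: AhlforsCA1979, Ch. 4 §2.1 (index of a point with respect to a closed curve)]
[cite: Glazman2015WeightedSAW, Lemma 3.1 (proof, pp. 6–7: the classes of walks through a rhombus)] -/
theorem false_of_under_excursion_rootSS_W (hh : holeFaceW w ∉ D) (hr : RootedFace D (w.side .W) (farW w))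
    (h : ω.IsB2a) (hS : ω.2.firstSideG = .S)
    (hdoor : ((w.1 - 1, w.2 - 1) : Face) ∉ D ∨ rootS w ∉ D)
    (hJ : ∃ j, j < ω.Mv ∧ (ω.jFace h j).side (ω.jOut hr h j) = (rootSS w).side .W) : False := by
  have hM := ω.three_le_Mv hr h
  have hF := ω.fh_lt h
  have h1 := ω.one_le_firstHitG_far
  have hlen : ω.2.arcs.length = ω.2.firstHitG + ω.Mv := len_eq h
  set F := ω.2.firstHitG with hFdef
  set n := ω.2.arcs.length with hndef
  have hnthF : ω.2.nth F = (farW w).side .S := by rw [hFdef, ω.2.nth_firstHitG, hS]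
  obtain ⟨j, hj, hje⟩ := hJ
  -- the four auxiliary points
  set q1 : ℂ := toC ((holeFaceW w).base + Side.N.endA) with hq1
  set mN : ℂ := toC (midPt ((farW w).side .N)) with hmN
  set q3 : ℂ := toC ((rootS w).base + Side.W.endA) with hq3
  set mW : ℂ := toC (midPt ((rootSS w).side .W)) with hmW
  -- P1: the top side of the hole
  have hP1 : segment ℝ (cHi w) q1 = sideSeg (holeFaceW w) .N := by
    rw [segment_symm, sideSeg, cHi]
    congr 2
    obtain ⟨a, b⟩ := w; simp [holeFaceW, Face.base, Side.endB]; ring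
  have w1 : ω.windC (cHi w) = ω.windC q1 := by
    refine windC_eq_of_segment fun z hz k hk hzk => ?_
    rw [hP1] at hz
    obtain ⟨i, hi1, hiF, e⟩ := exists_nth_eq_of_mem_pCedge_sideSeg hh h hS hk hzk hz
      (fun q hq => not_mem_sideSeg_N_of_mem_fSeg_hSeg (by simp [holeFaceW]) hq)
    have hd := ω.2.door_nth (j := i) (by omega) (by omega)
    rw [e] at hd
    have : ((holeFaceW w).side .N).faces.1 = holeFaceW w := by
      obtain ⟨a, b⟩ := w; simp [holeFaceW, Face.side, MidEdge.faces]
    rw [this] at hd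
    exact hh hd.1
  -- P2: the right half of the top side of the far cell
  have hP2 : segment ℝ q1 mN ⊆ sideSeg (farW w) .N := by
    refine (convex_segment _ _).segment_subset ?_ (toC_midPt_side_mem_sideSeg _ _)
    have e : q1 = toC ((farW w).base + Side.N.endB) := by
      rw [hq1]; congr 1; obtain ⟨a, b⟩ := w; simp [holeFaceW, farW, Face.base, Side.endA, Side.endB]; ring
    rw [e]; exact right_mem_segment _ _ _
  have w2 : ω.windC q1 = ω.windC mN := by
    refine windC_eq_of_segment fun z hz k hk hzk => ?_
    obtain ⟨i, hi1, hiF, e⟩ := exists_nth_eq_of_mem_pCedge_sideSeg hh h hS hk hzk (hP2 hz)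
      (fun q hq => not_mem_sideSeg_N_of_mem_fSeg_hSeg (by simp [farW]) hq)
    have hle := firstHitG_le_of_nth_eq (ω := ω) (by omega) e
    have ei : i = F := by omega
    rw [ei, hnthF] at e
    exact absurd (Face.side_injective (farW w) e) (by decide)
  -- P3: the west side of `rootS w` (the dead door), from the lower corner of the root edge down
  have hP3 : segment ℝ (cLo w) q3 = sideSeg (rootS w) .W := by
    have e1 : cLo w = toC ((rootS w).base + Side.W.endB) := by
      rw [cLo]; congr 1; obtain ⟨a, b⟩ := w; simp [rootS, Face.base, Side.endA, Side.endB]; ring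
    rw [e1, hq3, sideSeg, segment_symm]
  have w3 : ω.windC (cLo w) = ω.windC q3 := by
    refine windC_eq_of_segment fun z hz k hk hzk => ?_
    rw [hP3] at hz
    obtain ⟨i, hi1, hiF, e⟩ := exists_nth_eq_of_mem_pCedge_sideSeg hh h hS hk hzk hz
      (fun q hq => not_mem_sideSeg_W_of_mem_fSeg_hSeg w (by simp [rootS]) (by simp [rootS]) hq)
    have hd := ω.2.door_nth (j := i) (by omega) (by omega)
    rw [e, rootS_side_W_faces] at hd
    rcases hdoor with hd' | hd'
    · exact hd' hd.1
    · exact hd' hd.2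
  -- P4: the upper half of the west side of `rootSS w` (the excursion's own mid-edge)
  have hP4 : segment ℝ q3 mW ⊆ sideSeg (rootSS w) .W := by
    refine (convex_segment _ _).segment_subset ?_ (toC_midPt_side_mem_sideSeg _ _)
    have e : q3 = toC ((rootSS w).base + Side.W.endB) := by
      rw [hq3]; congr 1; obtain ⟨a, b⟩ := w; simp [rootS, rootSS, Face.base, Side.endA, Side.endB]; ring
    rw [e]; exact right_mem_segment _ _ _
  have w4 : ω.windC q3 = ω.windC mW := by
    refine windC_eq_of_segment fun z hz k hk hzk => ?_
    obtain ⟨i, hi1, hiF, e⟩ := exists_nth_eq_of_mem_pCedge_sideSeg hh h hS hk hzk (hP4 hz)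
      (fun q hq => not_mem_sideSeg_W_of_mem_fSeg_hSeg w (by simp [rootSS]) (by simp [rootSS]) hq)
    rw [← hje, side_jOut (hr := hr) h hj] at e
    have := ω.2.nth_inj (by omega) (by omega) e
    omega
  -- the two midpoints lie on `J`
  obtain ⟨j₀, hj₀, hj₀e⟩ := exists_jOut_eq_farW_N hh hr h hS
  have wN : ω.windC mN = ω.windC (ω.pJ hr h 0) := by
    refine windC_pJ_edge hh hr h hS (k := 2 * j₀) (by omega) ?_
    rw [segment_pJ_even h hj₀, hj₀e]
    exact toC_midPt_mem_crossSeg _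
  have wW : ω.windC mW = ω.windC (ω.pJ hr h 0) := by
    refine windC_pJ_edge hh hr h hS (k := 2 * j) (by omega) ?_
    rw [segment_pJ_even h hj, hje]
    exact toC_midPt_mem_crossSeg _
  have := windC_jump hh h hS
  rw [w1, w2, wN, ← wW, ← w4, ← w3, sub_self] at this
  exact zero_ne_one this

/-! ## §2 The even–odd rule for the lower east with a dead door and a floor -/

/-- ★★★ **DEAD DOOR + FLOOR ⇒ THE EXCURSION OF A WINDING WALK CROSSES THE `W` SIDE OF `rootSS`.** Hypotheses: the door
between `holeS` and `rootS w` dead, and the floor two rows below the hole — `(w.1 − 1, y) ∉ D` for every `y ≤ w.2 − 3`.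
The excursion of a class-`B2a` walk whose excursion polygon winds around the root crosses the west sides of the root
column below the root row an odd number of times (`ΩG.odd_card_westEdgeLE_of_AJ_ne_zero`); a crossed mid-edge has both
faces in `D`, so every such crossing is the west side of `rootSS w = (w.1, w.2 − 2)`.
[cite: CourantRobbins1958, Ch. V Appendix §2 (the even–odd rule)] [cite: Glazman2015WeightedSAW, Lemma 3.1 (proof, pp. 6–7)] -/
theorem exists_nth_eq_rootSS_W_of_AJ_ne_zero_deadDoor (hdoor : ((w.1 - 1, w.2 - 1) : Face) ∉ D ∨ rootS w ∉ D)
    (hfloor : ∀ y : ℤ, y ≤ w.2 - 3 → ((w.1 - 1, y) : Face) ∉ D)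
    (ω : ΩG D (w.side .W) (farW w)) (hr : RootedFace D (w.side .W) (farW w)) (h : ω.IsB2a)
    (hA : ω.AJ hr h (toC (midPt (w.side .W))) ≠ 0) :
    ∃ k, ω.2.firstHitG + 2 ≤ k ∧ k ≤ ω.2.arcs.length - 1 ∧ ω.2.nth k = (rootSS w).side .W := by
  classical
  have hodd := ω.odd_card_westEdgeLE_of_AJ_ne_zero hr h hA
  have hpos := hodd.pos
  rw [Finset.card_pos] at hpos
  obtain ⟨k, hk⟩ := hpos
  rw [Finset.mem_filter, Finset.mem_Ioc] at hk
  obtain ⟨⟨hk1, hk2⟩, hwest⟩ := hk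
  refine ⟨k, by omega, hk2, ?_⟩
  have hd := ω.2.door_nth (j := k) (by omega) (by omega)
  cases hnth : ω.2.nth k with
  | slant x y => rw [hnth] at hwest; exact absurd hwest (by simp [IsWestEdgeLE])
  | vert x y =>
    rw [hnth] at hwest hd
    simp only [IsWestEdgeLE] at hwest
    obtain ⟨hx, hy⟩ := hwest
    subst hx
    simp only [MidEdge.faces] at hd
    have hy1 : y ≠ w.2 - 1 := by
      rintro rfl
      rcases hdoor with hd' | hd'
      · exact hd' hd.1
      · exact hd' (by simpa [rootS] using hd.2)
    have hy3 : ¬ y ≤ w.2 - 3 := fun hle => hfloor y hle hd.1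
    have hy2 : y = w.2 - 2 := by omega
    rw [hy2, rootSS_side_W_eq]

/-- ★★★ The wound form (either orientation of the winding witness: the reversed companion has the same prefix and
traverses the same excursion mid-edges backwards). [cite: GlazmanManolescu2019, Lemma 2.1 (statement, "in the form given in [Gl]")]
[cite: Glazman2015WeightedSAW, Lemma 3.1 (proof, pp. 6–7)] [cite: CourantRobbins1958, Ch. V Appendix §2 (the even–odd rule)] -/
theorem exists_excursion_nth_eq_rootSS_W_of_wound_deadDoor (hdoor : ((w.1 - 1, w.2 - 1) : Face) ∉ D ∨ rootS w ∉ D)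
    (hfloor : ∀ y : ℤ, y ≤ w.2 - 3 → ((w.1 - 1, y) : Face) ∉ D)
    (ω : ΩG D (w.side .W) (farW w)) (hr : RootedFace D (w.side .W) (farW w)) (h : ω.IsB2a) {θ : ℝ}
    (hW : ω.WE (fun _ => θ) ≠ excursionWinding θ ω.2.firstSideG (ω.z1 hr h) ω.1) :
    ∃ k, ω.2.firstHitG + 2 ≤ k ∧ k ≤ ω.2.arcs.length - 1 ∧ ω.2.nth k = (rootSS w).side .W := by
  rcases ω.AJ_ne_zero_or_rev_of_wound hr h θ hW with hA | hA
  · exact exists_nth_eq_rootSS_W_of_AJ_ne_zero_deadDoor hdoor hfloor ω hr h hA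
  · have h' := ω.rev_isB2a hr h
    obtain ⟨k, hk1, hk2, e⟩ := exists_nth_eq_rootSS_W_of_AJ_ne_zero_deadDoor hdoor hfloor (ω.rev hr) hr h' hA
    have hF : (ω.rev hr).2.firstHitG = ω.2.firstHitG := rev_firstHit ω hr h
    have hn : (ω.rev hr).2.arcs.length = ω.2.arcs.length := rev_snd_length ω hr h
    rw [hF] at hk1
    rw [hn] at hk2
    rw [rev_snd_nth ω hr h (by omega), if_neg (by omega)] at e
    exact ⟨ω.2.arcs.length + ω.2.firstHitG + 1 - k, by omega, by omega, e⟩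

/-! ## §3 Dead door + floor ⇒ no wound under-walk; the row-mirror twin; vacuous kills and vanishing masses -/

/-- ★★★★★ **DEAD DOOR + FLOOR ⇒ NO WOUND UNDER-WALK.** Hole absent; `holeS = (w.1 − 1, w.2 − 1)` or `rootS w` absent; the
column of the hole shut from two rows below the hole downwards (`(w.1 − 1, y) ∉ D`, `y ≤ w.2 − 3`). Then every class-`B2a`
UNDER-walk at the far cell (first side `S`) is unwound — in every domain, whatever else is present or absent. (The lane's
tight-room datum: in the box with the hole two rows above the bottom wall, removing the cell below the hole or below the
root plaquette EMPTIES the under route; `PlaquetteWalkHoleRootNearCells`: with three rows below, nothing is killed.)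
[cite: GlazmanManolescu2019, Lemma 2.1 (statement, "in the form given in [Gl]"), §1 (Fig. 2)]
[cite: Glazman2015WeightedSAW, Lemma 3.1 (proof, pp. 6–7)] [cite: CourantRobbins1958, Ch. V Appendix §2 (the even–odd rule)]
[cite: AhlforsCA1979, Ch. 4 §2.1 (index of a point with respect to a closed curve)] -/
theorem WE_eq_excursionWinding_of_under_deadDoor_floor (hh : holeFaceW w ∉ D)
    (hdoor : ((w.1 - 1, w.2 - 1) : Face) ∉ D ∨ rootS w ∉ D)
    (hfloor : ∀ y : ℤ, y ≤ w.2 - 3 → ((w.1 - 1, y) : Face) ∉ D)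
    (ω : ΩG D (w.side .W) (farW w)) (hr : RootedFace D (w.side .W) (farW w)) (h : ω.IsB2a)
    (hS : ω.2.firstSideG = .S) (θ : ℝ) :
    ω.WE (fun _ => θ) = excursionWinding θ ω.2.firstSideG (ω.z1 hr h) ω.1 := by
  by_contra hW
  obtain ⟨k, hk1, hk2, e⟩ := exists_excursion_nth_eq_rootSS_W_of_wound_deadDoor hdoor hfloor ω hr h hW
  have hlen : ω.2.arcs.length = ω.2.firstHitG + ω.Mv := len_eq h
  refine false_of_under_excursion_rootSS_W hh hr h hS hdoor ⟨k - ω.2.firstHitG - 1, by omega, ?_⟩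
  rw [side_jOut (hr := hr) h (by omega), show ω.2.firstHitG + (k - ω.2.firstHitG - 1) + 1 = k by omega, e]

/-- The reflection in the root row on a cell, in coordinates. [cite: GlazmanManolescu2019, §4.2 (lattice symmetries)] -/
private theorem mirrorRowFace_mkD (w : Face) (x y : ℤ) : mirrorRowFace w.2 ((x, y) : Face) = (x, 2 * w.2 - y) := by
  simp [mirrorRowFace]

/-- ★★★★★ **DEAD DOOR + CEILING ⇒ NO WOUND OVER-WALK** (row-mirror twin): hole absent; `holeN = (w.1 − 1, w.2 + 1)` or
`rootN w` absent; the column of the hole shut from two rows above the hole upwards (`(w.1 − 1, y) ∉ D`, `w.2 + 3 ≤ y`).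
Then every class-`B2a` OVER-walk at the far cell (first side `N`) is unwound. Transport through `ΩG.mirrorFar`: over-walks
of `D` are under-walks of the reflected domain, wound to wound. [cite: GlazmanManolescu2019, §1 (Fig. 1, Fig. 2), §4.2 (lattice symmetries), Lemma 2.1]
[cite: Glazman2015WeightedSAW, Lemma 3.1 (proof, pp. 6–7)] [cite: CourantRobbins1958, Ch. V Appendix §2 (the even–odd rule)] -/
theorem WE_eq_excursionWinding_of_over_deadDoor_ceiling (hh : holeFaceW w ∉ D)
    (hdoor : ((w.1 - 1, w.2 + 1) : Face) ∉ D ∨ rootN w ∉ D)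
    (hceil : ∀ y : ℤ, w.2 + 3 ≤ y → ((w.1 - 1, y) : Face) ∉ D)
    (ω : ΩG D (w.side .W) (farW w)) (hr : RootedFace D (w.side .W) (farW w)) (h : ω.IsB2a)
    (hN : ω.2.firstSideG = .N) (θ : ℝ) :
    ω.WE (fun _ => θ) = excursionWinding θ ω.2.firstSideG (ω.z1 hr h) ω.1 := by
  by_contra hW
  have hr' := rootedFace_rowMirrorDom w hr
  have h' := ω.mirrorFar_isB2a hr h
  have hh' : holeFaceW w ∉ rowMirrorDom w D := by rwa [mem_rowMirrorDom, mirrorRowFace_holeFaceW]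
  have hdoor' : ((w.1 - 1, w.2 - 1) : Face) ∉ rowMirrorDom w D ∨ rootS w ∉ rowMirrorDom w D := by
    rcases hdoor with hd | hd
    · left
      rw [mem_rowMirrorDom, mirrorRowFace_mkD, show 2 * w.2 - (w.2 - 1) = w.2 + 1 by ring]; exact hd
    · right
      rw [mem_rowMirrorDom, mirrorRowFace_rootS]; exact hd
  have hfloor' : ∀ y : ℤ, y ≤ w.2 - 3 → ((w.1 - 1, y) : Face) ∉ rowMirrorDom w D := by
    intro y hy
    rw [mem_rowMirrorDom, mirrorRowFace_mkD]
    exact hceil (2 * w.2 - y) (by omega)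
  have hS' : ω.mirrorFar.2.firstSideG = .S := by rw [mirrorFar_firstSideG, hN]; rfl
  exact absurd (WE_eq_excursionWinding_of_under_deadDoor_floor hh' hdoor' hfloor' ω.mirrorFar hr' h' hS' _)
    (ω.mirrorFar_wound hr h hW)

/-- ★★★ Both under-route kill statements of LAW L («every wound under-walk is `w₂`-marked / `w₁`-marked off the far cell»)
hold VACUOUSLY under a dead door `holeS | rootS` with a floor two rows below the hole. [cite: GlazmanManolescu2019, §1 (Fig. 2 and the remark after eq. (1))] -/
theorem under_killed_both_of_deadDoor_floor (hh : holeFaceW w ∉ D)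
    (hdoor : ((w.1 - 1, w.2 - 1) : Face) ∉ D ∨ rootS w ∉ D)
    (hfloor : ∀ y : ℤ, y ≤ w.2 - 3 → ((w.1 - 1, y) : Face) ∉ D) (hr : RootedFace D (w.side .W) (farW w)) (θ : ℝ) :
    (∀ (ω : ΩG D (w.side .W) (farW w)) (h : ω.IsB2a), ω.2.firstSideG = .S →
        ω.WE (fun _ => θ) ≠ excursionWinding θ ω.2.firstSideG (ω.z1 hr h) ω.1 → ¬ω.2.W2FreeOff (farW w)) ∧
      (∀ (ω : ΩG D (w.side .W) (farW w)) (h : ω.IsB2a), ω.2.firstSideG = .S →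
        ω.WE (fun _ => θ) ≠ excursionWinding θ ω.2.firstSideG (ω.z1 hr h) ω.1 → ¬ω.2.W1FreeOff (farW w)) :=
  ⟨fun ω h hS hW => absurd (WE_eq_excursionWinding_of_under_deadDoor_floor hh hdoor hfloor ω hr h hS θ) hW,
    fun ω h hS hW => absurd (WE_eq_excursionWinding_of_under_deadDoor_floor hh hdoor hfloor ω hr h hS θ) hW⟩

/-- ★★★ Both over-route kill statements of LAW L hold VACUOUSLY under a dead door `holeN | rootN` with a ceiling two rows above
the hole. [cite: GlazmanManolescu2019, §1 (Fig. 2 and the remark after eq. (1))] -/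
theorem over_killed_both_of_deadDoor_ceiling (hh : holeFaceW w ∉ D)
    (hdoor : ((w.1 - 1, w.2 + 1) : Face) ∉ D ∨ rootN w ∉ D)
    (hceil : ∀ y : ℤ, w.2 + 3 ≤ y → ((w.1 - 1, y) : Face) ∉ D) (hr : RootedFace D (w.side .W) (farW w)) (θ : ℝ) :
    (∀ (ω : ΩG D (w.side .W) (farW w)) (h : ω.IsB2a), ω.2.firstSideG = .N →
        ω.WE (fun _ => θ) ≠ excursionWinding θ ω.2.firstSideG (ω.z1 hr h) ω.1 → ¬ω.2.W1FreeOff (farW w)) ∧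
      (∀ (ω : ΩG D (w.side .W) (farW w)) (h : ω.IsB2a), ω.2.firstSideG = .N →
        ω.WE (fun _ => θ) ≠ excursionWinding θ ω.2.firstSideG (ω.z1 hr h) ω.1 → ¬ω.2.W2FreeOff (farW w)) :=
  ⟨fun ω h hN hW => absurd (WE_eq_excursionWinding_of_over_deadDoor_ceiling hh hdoor hceil ω hr h hN θ) hW,
    fun ω h hN hW => absurd (WE_eq_excursionWinding_of_over_deadDoor_ceiling hh hdoor hceil ω hr h hN θ) hW⟩

/-- ★★★ **THE UNDER ROUTE MASS VANISHES IDENTICALLY** under a dead door `holeS | rootS` with a floor, at every angle.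
[cite: GlazmanManolescu2019, Lemma 2.1 (statement, "in the form given in [Gl]")] -/
theorem sum_routeMassW_S_eq_zero_of_deadDoor_floor [Finite D] (hh : holeFaceW w ∉ D)
    (hdoor : ((w.1 - 1, w.2 - 1) : Face) ∉ D ∨ rootS w ∉ D)
    (hfloor : ∀ y : ℤ, y ≤ w.2 - 3 → ((w.1 - 1, y) : Face) ∉ D) (hr : RootedFace D (w.side .W) (farW w)) (θ : ℝ) :
    ∑ ω ∈ setB2a D (w.side .W) (farW w), routeMassW θ hr .S ω = 0 := by
  classical
  refine Finset.sum_eq_zero fun ω _ => ?_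
  unfold routeMassW
  split_ifs with h1 h2
  · exact absurd (WE_eq_excursionWinding_of_under_deadDoor_floor hh hdoor hfloor ω hr h1 h2.1 θ) h2.2
  · rfl
  · rfl

/-- ★★★ **THE OVER ROUTE MASS VANISHES IDENTICALLY** under a dead door `holeN | rootN` with a ceiling, at every angle.
[cite: GlazmanManolescu2019, Lemma 2.1 (statement, "in the form given in [Gl]")] -/
theorem sum_routeMassW_N_eq_zero_of_deadDoor_ceiling [Finite D] (hh : holeFaceW w ∉ D)
    (hdoor : ((w.1 - 1, w.2 + 1) : Face) ∉ D ∨ rootN w ∉ D)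
    (hceil : ∀ y : ℤ, w.2 + 3 ≤ y → ((w.1 - 1, y) : Face) ∉ D) (hr : RootedFace D (w.side .W) (farW w)) (θ : ℝ) :
    ∑ ω ∈ setB2a D (w.side .W) (farW w), routeMassW θ hr .N ω = 0 := by
  classical
  refine Finset.sum_eq_zero fun ω _ => ?_
  unfold routeMassW
  split_ifs with h1 h2
  · exact absurd (WE_eq_excursionWinding_of_over_deadDoor_ceiling hh hdoor hceil ω hr h1 h2.1 θ) h2.2
  · rfl
  · rfl

/-- ★★★★ **BOTH DOORS DEAD, FLOOR AND CEILING ⇒ NO WOUND WALK AT ALL** (the height-four thin box of the lane with the cell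
below and the cell above the hole's row broken on the two sides). [cite: GlazmanManolescu2019, Lemma 2.1 (statement, "in the form given in [Gl]")]
[cite: Glazman2015WeightedSAW, Lemma 3.1 (proof, pp. 6–7)] -/
theorem WE_eq_excursionWinding_of_deadDoors_floor_ceiling (hh : holeFaceW w ∉ D)
    (hdoorS : ((w.1 - 1, w.2 - 1) : Face) ∉ D ∨ rootS w ∉ D)
    (hfloor : ∀ y : ℤ, y ≤ w.2 - 3 → ((w.1 - 1, y) : Face) ∉ D)
    (hdoorN : ((w.1 - 1, w.2 + 1) : Face) ∉ D ∨ rootN w ∉ D)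
    (hceil : ∀ y : ℤ, w.2 + 3 ≤ y → ((w.1 - 1, y) : Face) ∉ D)
    (ω : ΩG D (w.side .W) (farW w)) (hr : RootedFace D (w.side .W) (farW w)) (h : ω.IsB2a) (θ : ℝ) :
    ω.WE (fun _ => θ) = excursionWinding θ ω.2.firstSideG (ω.z1 hr h) ω.1 := by
  by_contra hW
  rcases ω.AJ_ne_zero_or_rev_of_wound hr h θ hW with hA | hA
  · rcases firstSide_eq_N_or_S_of_wound hh ω hr h hA with hN | hS
    · exact hW (WE_eq_excursionWinding_of_over_deadDoor_ceiling hh hdoorN hceil ω hr h hN θ)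
    · exact hW (WE_eq_excursionWinding_of_under_deadDoor_floor hh hdoorS hfloor ω hr h hS θ)
  · have h' := ω.rev_isB2a hr h
    rcases firstSide_eq_N_or_S_of_wound hh (ω.rev hr) hr h' hA with hN | hS
    · rw [ω.rev_firstSide hr h] at hN
      exact hW (WE_eq_excursionWinding_of_over_deadDoor_ceiling hh hdoorN hceil ω hr h hN θ)
    · rw [ω.rev_firstSide hr h] at hS
      exact hW (WE_eq_excursionWinding_of_under_deadDoor_floor hh hdoorS hfloor ω hr h hS θ)

end ΩG

end Literature.Probability.RandomPlanarGeometry.SAW.YangBaxter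

namespace Literature.Barriers.CriticalPhenomena.PlaquetteWalk

open Literature.Probability.RandomPlanarGeometry.SAW.YangBaxter
open Real Complex

/-! ## §3′ The vertex functional: one route empty, the other alive -/

section DeadDoorVF

variable {Dl : List Face} {w : Face}

/-- ★★★★ **DEAD DOOR BELOW + FLOOR, OVER WITNESSES OF BOTH KINDS ⇒ `Im VF(θ) > 0` ON THE WHOLE RANGE** (`VF = i·v·M_N`,
`M_S ≡ 0`; at `π/3` the `w₂`-free over witness, at `2π/3` the `w₁`-free one, inside the range any wound over-walk weighs
positively). [cite: GlazmanManolescu2019, Lemma 2.1 (statement, "in the form given in [Gl]"), §1 eq. (1)]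
[cite: Glazman2015WeightedSAW, Lemma 3.1 (proof, pp. 6–7)] [cite: CourantRobbins1958, Ch. V Appendix §2 (the even–odd rule)] -/
theorem im_vertexFunctional_printed_pos_of_deadDoor_floor {θ : ℝ} (hθ : θ ∈ Set.Icc (π / 3) (2 * π / 3))
    (hf : farW w ∈ Dl) (hh : holeFaceW w ∉ dom Dl)
    (hdoor : ((w.1 - 1, w.2 - 1) : Face) ∉ dom Dl ∨ rootS w ∉ dom Dl)
    (hfloor : ∀ y : ℤ, y ≤ w.2 - 3 → ((w.1 - 1, y) : Face) ∉ dom Dl)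
    (hr : RootedFace (dom Dl) (w.side .W) (farW w))
    (hO2 : ∀ θ' : ℝ, ∃ (ω : ΩG (dom Dl) (w.side .W) (farW w)) (h : ω.IsB2a), ω.2.firstSideG = .N ∧
      ω.WE (fun _ => θ') ≠ excursionWinding θ' ω.2.firstSideG (ω.z1 hr h) ω.1 ∧ ω.2.W2FreeOff (farW w))
    (hO1 : ∀ θ' : ℝ, ∃ (ω : ΩG (dom Dl) (w.side .W) (farW w)) (h : ω.IsB2a), ω.2.firstSideG = .N ∧
      ω.WE (fun _ => θ') ≠ excursionWinding θ' ω.2.firstSideG (ω.z1 hr h) ω.1 ∧ ω.2.W1FreeOff (farW w)) :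
    0 < (vertexFunctional (printedWeights θ) tFiveEighths (ybCoeff θ) Dl (w.side .W) (farW w)).im := by
  rcases eq_or_lt_of_le hθ.1 with e1 | h1
  · rw [← e1]
    exact im_vertexFunctional_printed_farCellW_pi_div_three_pos_of_under_killed Dl w hf hh hr
      (ΩG.under_killed_both_of_deadDoor_floor hh hdoor hfloor hr _).1 (hO2 _)
  rcases eq_or_lt_of_le hθ.2 with e2 | h2
  · rw [e2]
    exact im_vertexFunctional_printed_farCellW_two_pi_div_three_pos_of_under_killed Dl w hf hh hr
      (ΩG.under_killed_both_of_deadDoor_floor hh hdoor hfloor hr _).2 (hO1 _)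
  have hθo : θ ∈ Set.Ioo (π / 3) (2 * π / 3) := ⟨h1, h2⟩
  rw [vertexFunctional_printed_farCellW_im_eq hθ Dl w hf hh hr,
    ΩG.sum_routeMassW_S_eq_zero_of_deadDoor_floor hh hdoor hfloor hr θ, sub_zero]
  obtain ⟨ω, h, hN, hW, -⟩ := hO2 θ
  exact mul_pos (weightV_pos_of_mem_Ioo ⟨by linarith [hθo.1, Real.pi_pos], by linarith [hθo.2, Real.pi_pos]⟩)
    (ΩG.sum_routeMassW_pos_of_wound hr .N hθo ⟨ω, h, hN, hW⟩)

/-- ★★★★ **DEAD DOOR ABOVE + CEILING, UNDER WITNESSES OF BOTH KINDS ⇒ `Im VF(θ) < 0` ON THE WHOLE RANGE** (`VF = −i·v·M_S`).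
[cite: GlazmanManolescu2019, Lemma 2.1 (statement, "in the form given in [Gl]"), §1 eq. (1)]
[cite: Glazman2015WeightedSAW, Lemma 3.1 (proof, pp. 6–7)] [cite: CourantRobbins1958, Ch. V Appendix §2 (the even–odd rule)] -/
theorem im_vertexFunctional_printed_neg_of_deadDoor_ceiling {θ : ℝ} (hθ : θ ∈ Set.Icc (π / 3) (2 * π / 3))
    (hf : farW w ∈ Dl) (hh : holeFaceW w ∉ dom Dl)
    (hdoor : ((w.1 - 1, w.2 + 1) : Face) ∉ dom Dl ∨ rootN w ∉ dom Dl)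
    (hceil : ∀ y : ℤ, w.2 + 3 ≤ y → ((w.1 - 1, y) : Face) ∉ dom Dl)
    (hr : RootedFace (dom Dl) (w.side .W) (farW w))
    (hU2 : ∀ θ' : ℝ, ∃ (ω : ΩG (dom Dl) (w.side .W) (farW w)) (h : ω.IsB2a), ω.2.firstSideG = .S ∧
      ω.WE (fun _ => θ') ≠ excursionWinding θ' ω.2.firstSideG (ω.z1 hr h) ω.1 ∧ ω.2.W2FreeOff (farW w))
    (hU1 : ∀ θ' : ℝ, ∃ (ω : ΩG (dom Dl) (w.side .W) (farW w)) (h : ω.IsB2a), ω.2.firstSideG = .S ∧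
      ω.WE (fun _ => θ') ≠ excursionWinding θ' ω.2.firstSideG (ω.z1 hr h) ω.1 ∧ ω.2.W1FreeOff (farW w)) :
    (vertexFunctional (printedWeights θ) tFiveEighths (ybCoeff θ) Dl (w.side .W) (farW w)).im < 0 := by
  rcases eq_or_lt_of_le hθ.1 with e1 | h1
  · rw [← e1]
    exact im_vertexFunctional_printed_farCellW_pi_div_three_neg_of_over_killed Dl w hf hh hr
      (ΩG.over_killed_both_of_deadDoor_ceiling hh hdoor hceil hr _).2 (hU2 _)
  rcases eq_or_lt_of_le hθ.2 with e2 | h2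
  · rw [e2]
    exact im_vertexFunctional_printed_farCellW_two_pi_div_three_neg_of_over_killed Dl w hf hh hr
      (ΩG.over_killed_both_of_deadDoor_ceiling hh hdoor hceil hr _).1 (hU1 _)
  have hθo : θ ∈ Set.Ioo (π / 3) (2 * π / 3) := ⟨h1, h2⟩
  rw [vertexFunctional_printed_farCellW_im_eq hθ Dl w hf hh hr,
    ΩG.sum_routeMassW_N_eq_zero_of_deadDoor_ceiling hh hdoor hceil hr θ, zero_sub, mul_neg, neg_lt_zero]
  obtain ⟨ω, h, hS, hW, -⟩ := hU2 θ
  exact mul_pos (weightV_pos_of_mem_Ioo ⟨by linarith [hθo.1, Real.pi_pos], by linarith [hθo.2, Real.pi_pos]⟩)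
    (ΩG.sum_routeMassW_pos_of_wound hr .S hθo ⟨ω, h, hS, hW⟩)

/-- ★★★ **BOTH DOORS DEAD, FLOOR AND CEILING ⇒ `VF ≡ 0`** on `[π/3, 2π/3]`.
[cite: GlazmanManolescu2019, Lemma 2.1 (statement, "in the form given in [Gl]")] [cite: Glazman2015WeightedSAW, Lemma 3.1 (proof, pp. 6–7)] -/
theorem vertexFunctional_printed_eq_zero_of_deadDoors_floor_ceiling {θ : ℝ} (hθ : θ ∈ Set.Icc (π / 3) (2 * π / 3))
    (hf : farW w ∈ Dl) (hh : holeFaceW w ∉ dom Dl)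
    (hdoorS : ((w.1 - 1, w.2 - 1) : Face) ∉ dom Dl ∨ rootS w ∉ dom Dl)
    (hfloor : ∀ y : ℤ, y ≤ w.2 - 3 → ((w.1 - 1, y) : Face) ∉ dom Dl)
    (hdoorN : ((w.1 - 1, w.2 + 1) : Face) ∉ dom Dl ∨ rootN w ∉ dom Dl)
    (hceil : ∀ y : ℤ, w.2 + 3 ≤ y → ((w.1 - 1, y) : Face) ∉ dom Dl) :
    vertexFunctional (printedWeights θ) tFiveEighths (ybCoeff θ) Dl (w.side .W) (farW w) = 0 := by
  have hr : RootedFace (dom Dl) (w.side .W) (farW w) := ⟨hf, fun hb => hh (by rw [root_faces_W] at hb; exact hb.1)⟩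
  rw [vertexFunctional_printed_farCellW_eq hθ Dl w hf hh hr,
    ΩG.sum_routeMassW_S_eq_zero_of_deadDoor_floor hh hdoorS hfloor hr θ,
    ΩG.sum_routeMassW_N_eq_zero_of_deadDoor_ceiling hh hdoorN hceil hr θ]
  simp

end DeadDoorVF

end Literature.Barriers.CriticalPhenomena.PlaquetteWalk
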